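import Summits.KontsevichZagierPeriods.Zeta5Search.TwoTaleOmega.StepEL
import Summits.KontsevichZagierPeriods.Zeta5Search.TwoTaleOmega.OmegaRegionR
import Summits.KontsevichZagierPeriods.Zeta5Search.TwoTaleOmega.CertAtomsA

/-!
# (bmiss)@Ω — the recurrence in direction `a`, FIRST TALE (cell `pub-zeta5`, cert-1 gen 4)

HONEST FRAMING: systematic search; recurrence certificates; no irrationality claim unless certified. Pure finite algebra
over `ℚ`; no named fact, no `sorry`.

Blueprint `families/tele/RECURRENCE.md` §13.10–13.12, direction `δ = a = (1,0,0,0,0)`, side `L`, on the template of `StepEL`.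
INPUT: cert-2's `telescope_a_L` (`Cert_L = t(t+g−1)(t+a−e+3)(t+a−f+3)·x_L(t)/((t+a−e+1)(t+a−f+1)(t+a−e+2)(t+a−f+2)(t+a−e+3)(t+a−f+3))`,
`x_L` the cubic `xPolyAL`; atoms opaque, `CertAtomsA`). Along `δ_a` the numerator blocks `[a−e+1,f)`, `[a−f+1,b)` and the denominator
block `[a,g)` all SHRINK from below: `F_L(p+kδ;t)·block(a−e+1,a−e+1+k)(t)·block(a−f+1,a−f+1+k)(t) = block(a,a+k)(t)·F_L(p;t)`
(`vL_ratio_addA`). KEY SIMPLIFICATION: at the base point of an `a`-step (`p+3δ_a ∈ Ω` forces `f ≥ a−e+4`, `b ≥ a−min(e,f)+4`) the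
certificate denominators divide `num`, so the telescoped function is the simple-pole datum
`GfAL = ofFrac [a,g−1) 1 (block(0,e)·block(a−e+3,f)·block(a−f+3,b)·x_L)`. The first-tale node `1 − a₂*` does NOT move along `δ_a`
(`nodeL_addA`), so no node moves are needed; legitimacy at `s* = node(p)` is the double zero of `N_G`. OUTPUT `recL_a`
(truncation `d⁺ + 10`). (The `U`-step of direction `a` needs the second tale, whose common node is NOT `−a` — see HANDOFF.)
-/

noncomputable section

open Finset Polynomial
open Literature.NumberTheory.Irrationality.Zudilin2014
open Summit.KontsevichZagierPeriods.Zeta5Search.FormalBarnes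
open Summit.KontsevichZagierPeriods.Zeta5Search.Certificates.TwoTaleTelescope

namespace Summit.KontsevichZagierPeriods.Zeta5Search.TwoTaleOmega

namespace Pt

variable (p : Pt)

/-! ### The telescoper of direction `a` at a point -/

/-- cert-2's telescoper coefficients `c^a_0..c^a_3` of direction `a`, evaluated at `p`. -/
def coefA : Fin 4 → ℚ :=
  ![spvalC Certificates.TwoTaleTelescope.cA0 (p.a : ℚ) p.b p.e p.f p.g,
    spvalC Certificates.TwoTaleTelescope.cA1 (p.a : ℚ) p.b p.e p.f p.g,
    spvalC Certificates.TwoTaleTelescope.cA2 (p.a : ℚ) p.b p.e p.f p.g,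
    spvalC Certificates.TwoTaleTelescope.cA3 (p.a : ℚ) p.b p.e p.f p.g]

variable {p}

/-- The first-tale node does not move along `δ_a` (both points in Ω). -/
theorem nodeL_addA (h0 : p.Omega) {k : ℤ} (hk : (p.addA k).Omega) : (p.addA k).nodeL = p.nodeL := by
  have e1 := a2star_t1a_eq h0
  have e2 := a2star_t1a_eq hk
  simp only [addA_b, addA_e, addA_f] at e2
  show 1 - a2star (p.addA k).t1a = 1 - a2star p.t1a
  rw [e1, e2]

/-! ### Block algebra along `δ_a` -/

/-- Along `δ_a` the numerator loses bottom factors: `num(p) = num(p+kδ)·block(a−e+1,a−e+1+k)·block(a−f+1,a−f+1+k)`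
(`k ≥ 0`, `p+kδ ∈ Ω`). -/
theorem num_addA_mul {k : ℤ} (hk : (p.addA k).Omega) (hk0 : 0 ≤ k) :
    num p.t1a p.t1b = num (p.addA k).t1a (p.addA k).t1b
      * (block (p.a - p.e + 1) (p.a - p.e + 1 + k) * block (p.a - p.f + 1) (p.a - p.f + 1 + k)) := by
  have := hk.b_ge; have := hk.f_le; have := hk.e_le; have := hk.twoE; have := hk.twoF
  simp only [addA_a, addA_b, addA_e, addA_f] at *
  rw [num_t1, num_t1]
  simp only [addA_a, addA_b, addA_e, addA_f]
  rw [← block_mul_block (lo := p.a - p.e + 1) (mi := p.a - p.e + 1 + k) (hi := p.f) (by omega) (by omega),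
    ← block_mul_block (lo := p.a - p.f + 1) (mi := p.a - p.f + 1 + k) (hi := p.b) (by omega) (by omega),
    show p.a + k - p.e + 1 = p.a - p.e + 1 + k by ring, show p.a + k - p.f + 1 = p.a - p.f + 1 + k by ring]
  ring

/-- Along `δ_a` the denominator loses bottom factors: `den(p) = block(a,a+k)·den(p+kδ)` (`k ≥ 0`, `p+kδ ∈ Ω`). -/
theorem den_addA_mul {k : ℤ} (hk : (p.addA k).Omega) (hk0 : 0 ≤ k) :
    den p.t1a p.t1b = block p.a (p.a + k) * den (p.addA k).t1a (p.addA k).t1b := by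
  have := hk.a_lt_g
  simp only [addA_a, addA_g] at this
  rw [den_t1, den_t1]
  simp only [addA_a, addA_g]
  exact (block_mul_block (lo := p.a) (mi := p.a + k) (hi := p.g) (by omega) (by omega)).symm

/-- **Γ-ratio along `δ_a`, first tale**: `F_L(p+kδ;t)·block(a−e+1,a−e+1+k)(t)·block(a−f+1,a−f+1+k)(t) = block(a,a+k)(t)·F_L(p;t)`
off the poles. -/
theorem vL_ratio_addA (h0 : p.Omega) {k : ℤ} (hk : (p.addA k).Omega) (hk0 : 0 ≤ k) {t : ℚ}
    (ht : ∀ j ∈ Ico p.a p.g, t + j ≠ 0) :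
    (p.addA k).vL.eval t * ((block (p.a - p.e + 1) (p.a - p.e + 1 + k)).eval t * (block (p.a - p.f + 1) (p.a - p.f + 1 + k)).eval t)
      = (block p.a (p.a + k)).eval t * p.vL.eval t := by
  have hg := hk.a_lt_g
  simp only [addA_a, addA_g] at hg
  have htk : ∀ j ∈ Ico (p.addA k).a (p.addA k).g, t + j ≠ 0 := fun j hj => by
    simp only [addA_a, addA_g, mem_Ico] at hj; exact ht j (by rw [mem_Ico]; omega)
  have hDk : (den (p.addA k).t1a (p.addA k).t1b).eval t ≠ 0 := den_eval_ne_zero _ htk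
  have hBa : (block p.a (p.a + k)).eval t ≠ 0 := by
    rw [eval_block]; exact prod_ne_zero_iff.2 fun i hi => by rw [mem_Ico] at hi; exact ht i (by rw [mem_Ico]; omega)
  rw [vL_eval_w hk htk, vL_eval_w h0 ht, num_addA_mul hk hk0, den_addA_mul hk hk0]
  simp only [eval_mul]
  field_simp

/-! ### The telescoped function `G = Cert_L · F_L(p;·)` as closed-form data -/

variable (p)

/-- Numerator of `G_{a,L}`: the blocks of `num` with the certificate denominators cancelled, times `t` and the cubic `x_L`. -/
def NfAL : ℚ[X] :=
  block 0 p.e * block (p.a - p.e + 3) p.f * block (p.a - p.f + 3) p.b * xPolyAL (p.a : ℚ) p.b p.e p.f p.g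

/-- **The telescoped data** `G_{a,L}(p) = ofFrac [a,g−1) 1 (N_G)`. -/
def GfAL : PF := PF.ofFrac (Ico p.a (p.g - 1)) (fun _ => 1) p.NfAL

/-- The poles of `G_{a,L}` lie in `[a,g−1)`. -/
theorem poles_GfAL : p.GfAL.poles ⊆ Ico p.a (p.g - 1) := PF.poles_ofFrac _ _ _

/-- Degree bound of `N_G`. -/
theorem natDegree_NfAL_le :
    p.NfAL.natDegree ≤ (p.e - 0).toNat + (p.f - (p.a - p.e + 3)).toNat + (p.b - (p.a - p.f + 3)).toNat + 3 := by
  unfold NfAL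
  refine (natDegree_mul_le).trans (Nat.add_le_add ?_ (natDegree_xPolyAL_le _ _ _ _ _))
  refine (natDegree_mul_le).trans (Nat.add_le_add ((natDegree_mul_le).trans (Nat.add_le_add ?_ ?_)) ?_) <;>
    rw [natDegree_block]

/-- Degree of the polynomial part of `G_{a,L}`: `≤ d⁺ + 10`. -/
theorem natDegree_GfAL_le (h : p.Omega) : p.GfAL.poly.natDegree ≤ dExp p.t1a p.t1b + 10 := by
  unfold GfAL
  have hN := natDegree_NfAL_le p
  rw [PF.natDegree_ofFrac, sum_const, Int.card_Ico, smul_eq_mul, mul_one]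
  unfold dExp; rw [sum_t1a_sub_sum_t1b]; unfold dInt
  obtain ⟨h1, h2, h3, h4, h5, h6, h7, h8, h9⟩ := h
  omega

/-- The inequalities forced at the base point of an `a`-step by `p + 3δ_a ∈ Ω`. -/
theorem base_ineq_addA (h3 : (p.addA 3).Omega) :
    p.a + 4 ≤ 2 * p.e ∧ p.a + 4 ≤ 2 * p.f ∧ p.a - min p.e p.f + 4 ≤ p.b ∧ p.a + 4 ≤ p.g := by
  have := h3.twoE; have := h3.twoF; have := h3.b_ge; have := h3.a_lt_g
  simp only [addA_a, addA_b, addA_e, addA_f, addA_g] at *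
  omega

/-- `x_L` at `t` and at `t+1` are cert-2's atoms `polyTN xAL 0/1`. -/
theorem eval_xPolyAL_zero_one (a b e f g t : ℚ) : (xPolyAL a b e f g).eval t = polyTN xAL 0 a b e f g t ∧
    (xPolyAL a b e f g).eval (t + 1) = polyTN xAL 1 a b e f g t := by
  refine ⟨?_, ?_⟩
  · have := eval_xPolyAL 0 a b e f g t; push_cast at this; rwa [add_zero] at this
  · have := eval_xPolyAL 1 a b e f g t; push_cast at this; exact this

variable {p}

/-- **`G = Cert_L · F_L`** in certificate form: off the exceptional points,
`G_{a,L}(t) = t(t+g−1)(t+a−e+3)(t+a−f+3)·x_L(t)/((t+a−e+1)(t+a−f+1)(t+a−e+2)(t+a−f+2)(t+a−e+3)(t+a−f+3)) · num(t)/den(t)`. -/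
theorem GfAL_eval_cert (h0 : p.Omega) (h3 : (p.addA 3).Omega) {t : ℚ} (ht : ∀ K ∈ Icc (0 : ℤ) (p.g + 4), t + K ≠ 0) :
    p.GfAL.eval t = t * (t + (p.g - 1 : ℤ)) * (t + (p.a - p.e + 3 : ℤ)) * (t + (p.a - p.f + 3 : ℤ))
      * (xPolyAL (p.a : ℚ) p.b p.e p.f p.g).eval t
      / ((t + (p.a - p.e + 1 : ℤ)) * (t + (p.a - p.f + 1 : ℤ)) * (t + (p.a - p.e + 2 : ℤ)) * (t + (p.a - p.f + 2 : ℤ))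
        * (t + (p.a - p.e + 3 : ℤ)) * (t + (p.a - p.f + 3 : ℤ)))
      * ((num p.t1a p.t1b).eval t / (den p.t1a p.t1b).eval t) := by
  obtain ⟨b1, b2, b3, b4⟩ := base_ineq_addA p h3
  obtain ⟨o1, o2, o3, o4, o5, o6, o7, o8, o9⟩ := id h0
  have nz : ∀ K : ℤ, 0 ≤ K → K ≤ p.g + 4 → t + (K : ℚ) ≠ 0 := fun K h1 h2 => ht K (mem_Icc.2 ⟨h1, h2⟩)
  have hT : ∀ K ∈ Ico p.a (p.g - 1), t + K ≠ 0 := fun K hK => by rw [mem_Ico] at hK; exact nz K (by omega) (by omega)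
  have hden : (den p.t1a p.t1b).eval t ≠ 0 := den_eval_ne_zero p fun j hj => by
    rw [mem_Ico] at hj; exact nz j (by omega) (by omega)
  unfold GfAL NfAL
  rw [PF.eval_ofFrac _ _ _ (fun _ _ => Or.inl rfl) hT, denom_Ico_one, num_t1, den_t1,
    block_succ_left (lo := (0:ℤ)) (hi := p.e) (by omega), show (0:ℤ) + 1 = 1 by ring,
    block_succ_left (lo := p.a - p.e + 1) (hi := p.f) (by omega),
    block_succ_left (lo := p.a - p.e + 1 + 1) (hi := p.f) (by omega),
    show p.a - p.e + 1 + 1 + 1 = p.a - p.e + 3 by ring, show p.a - p.e + 1 + 1 = p.a - p.e + 2 by ring,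
    block_succ_left (lo := p.a - p.f + 1) (hi := p.b) (by omega),
    block_succ_left (lo := p.a - p.f + 1 + 1) (hi := p.b) (by omega),
    show p.a - p.f + 1 + 1 + 1 = p.a - p.f + 3 by ring, show p.a - p.f + 1 + 1 = p.a - p.f + 2 by ring,
    show p.g = (p.g - 1) + 1 by ring, block_succ_right (lo := p.a) (hi := p.g - 1) (by omega),
    show p.g - 1 + 1 = p.g by ring]
  rw [den_t1, show p.g = (p.g - 1) + 1 by ring, block_succ_right (lo := p.a) (hi := p.g - 1) (by omega)] at hden
  simp only [eval_mul, eval_lin] at hden ⊢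
  have hDa : (block p.a (p.g - 1)).eval t ≠ 0 := fun h => hden (by rw [h, zero_mul])
  have m1 := nz (p.a - p.e + 1) (by omega) (by omega)
  have m2 := nz (p.a - p.e + 2) (by omega) (by omega)
  have m3 := nz (p.a - p.e + 3) (by omega) (by omega)
  have m4 := nz (p.a - p.f + 1) (by omega) (by omega)
  have m5 := nz (p.a - p.f + 2) (by omega) (by omega)
  have m6 := nz (p.a - p.f + 3) (by omega) (by omega)
  have m7 := nz (p.g - 1) (by omega) (by omega)
  push_cast at m1 m2 m3 m4 m5 m6 m7 ⊢
  field_simp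
  ring

/-! ### Step (2): the function identity -/

variable (p) in
/-- The exceptional set for Lemma U (first tale, direction `a`): all integers `K ∈ [0, g+5]` (poles of the four data, of `G` and
its shift, and the zeros of every cleared denominator lie there). -/
def SaL : Finset ℤ := Icc 0 (p.g + 5)

set_option maxHeartbeats 1600000 in
/-- **Function identity** `Σ_k c^a_k(p) F_L(p+kδ_a;t) = G(t+1) − G(t)` off the exceptional set `SaL`. -/
theorem funId_aL (h0 : p.Omega) (h1 : (p.addA 1).Omega) (h2 : (p.addA 2).Omega) (h3 : (p.addA 3).Omega) {t : ℚ}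
    (ht : ∀ K ∈ p.SaL, t + K ≠ 0) :
    p.coefA 0 * p.vL.eval t + p.coefA 1 * (p.addA 1).vL.eval t + p.coefA 2 * (p.addA 2).vL.eval t
      + p.coefA 3 * (p.addA 3).vL.eval t = p.GfAL.eval (t + 1) - p.GfAL.eval t := by
  have o := h0
  obtain ⟨b1, b2, b3, b4⟩ := base_ineq_addA p h3
  obtain ⟨o1, o2, o3, o4, o5, o6, o7, o8, o9⟩ := h0
  have nz : ∀ K : ℤ, 0 ≤ K → K ≤ p.g + 5 → t + (K : ℚ) ≠ 0 := fun K h1 h2 => ht K (by unfold SaL; exact mem_Icc.2 ⟨h1, h2⟩)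
  have hI : ∀ K ∈ Icc (0 : ℤ) (p.g + 4), t + K ≠ 0 := fun K hK => by rw [mem_Icc] at hK; exact nz K hK.1 (by omega)
  have hI1 : ∀ K ∈ Icc (0 : ℤ) (p.g + 4), t + 1 + K ≠ 0 := fun K hK => by
    rw [mem_Icc] at hK; have := nz (K + 1) (by omega) (by omega); push_cast at this; rwa [add_assoc, add_comm (1:ℚ)]
  have hS : ∀ k ∈ Ico p.a p.g, t + k ≠ 0 := fun k hk => by rw [mem_Ico] at hk; exact nz k (by omega) (by omega)
  have hS1 : ∀ k ∈ Ico p.a p.g, t + 1 + k ≠ 0 := fun k hk => by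
    rw [mem_Ico] at hk; have := nz (k + 1) (by omega) (by omega); push_cast at this; rwa [add_assoc, add_comm (1:ℚ)]
  -- the four values and the shift
  set F0 := p.vL.eval t with hF0
  set F0' := p.vL.eval (t + 1) with hF0'
  have eN : (num p.t1a p.t1b).eval t / (den p.t1a p.t1b).eval t = F0 := (vL_eval_w o hS).symm
  have r1 := vL_ratio_addA o h1 (by norm_num) hS
  have r2 := vL_ratio_addA o h2 (by norm_num) hS
  have r3 := vL_ratio_addA o h3 (by norm_num) hS
  have na := eval_block_123 p.a t
  have ne1 := (eval_block_123 (p.a - p.e + 1) t).1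
  have ne2 := (eval_block_123 (p.a - p.e + 1) t).2.1
  have ne3 := (eval_block_123 (p.a - p.e + 1) t).2.2
  have nf1 := (eval_block_123 (p.a - p.f + 1) t).1
  have nf2 := (eval_block_123 (p.a - p.f + 1) t).2.1
  have nf3 := (eval_block_123 (p.a - p.f + 1) t).2.2
  rw [ne1, nf1, na.1] at r1
  rw [ne2, nf2, na.2.1] at r2
  rw [ne3, nf3, na.2.2] at r3
  rw [← hF0] at r1 r2 r3
  push_cast at r1 r2 r3
  have hshift := vL_shift o hS hS1
  rw [← hF0, ← hF0'] at hshift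
  push_cast at hshift
  -- the values of G
  have ex := eval_xPolyAL_zero_one (p.a : ℚ) p.b p.e p.f p.g t
  have eG0 := GfAL_eval_cert o h3 hI
  rw [eN, ex.1] at eG0
  have eG1 := GfAL_eval_cert o h3 (t := t + 1) hI1
  rw [← vL_eval_w o hS1, ← hF0', ex.2] at eG1
  -- cert-2's cleared identity, atoms opaque
  have hc := telescope_a_L (p.a : ℚ) p.b p.e p.f p.g t
  simp only [numAL0, denAL0, lprod_nil, mul_one, one_mul] at hc
  have c0 : p.coefA 0 = spvalC Certificates.TwoTaleTelescope.cA0 (p.a : ℚ) p.b p.e p.f p.g := rfl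
  have c1 : p.coefA 1 = spvalC Certificates.TwoTaleTelescope.cA1 (p.a : ℚ) p.b p.e p.f p.g := rfl
  have c2 : p.coefA 2 = spvalC Certificates.TwoTaleTelescope.cA2 (p.a : ℚ) p.b p.e p.f p.g := rfl
  have c3 : p.coefA 3 = spvalC Certificates.TwoTaleTelescope.cA3 (p.a : ℚ) p.b p.e p.f p.g := rfl
  -- non-vanishing of the cleared denominators
  have m1 := nz (p.a - p.e + 1) (by omega) (by omega)
  have m2 := nz (p.a - p.e + 2) (by omega) (by omega)
  have m3 := nz (p.a - p.e + 3) (by omega) (by omega)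
  have m4 := nz (p.a - p.e + 4) (by omega) (by omega)
  have n1 := nz (p.a - p.f + 1) (by omega) (by omega)
  have n2 := nz (p.a - p.f + 2) (by omega) (by omega)
  have n3 := nz (p.a - p.f + 3) (by omega) (by omega)
  have n4 := nz (p.a - p.f + 4) (by omega) (by omega)
  have h1' := nz 1 (by omega) (by omega)
  have hg := nz p.g (by omega) (by omega)
  push_cast at m1 m2 m3 m4 n1 n2 n3 n4 h1' hg
  have key := telescope_assembly (F0 := F0) (F0' := F0')
    (F1 := (p.addA 1).vL.eval t) (F2 := (p.addA 2).vL.eval t) (F3 := (p.addA 3).vL.eval t)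
    (c0 := p.coefA 0) (c1 := p.coefA 1) (c2 := p.coefA 2) (c3 := p.coefA 3) (s1 := 1) (s2 := 1) (s3 := 1)
    (n1 := lprod numAL1 (p.a : ℚ) p.b p.e p.f p.g t) (n2 := lprod numAL2 (p.a : ℚ) p.b p.e p.f p.g t)
    (n3 := lprod numAL3 (p.a : ℚ) p.b p.e p.f p.g t)
    (d1 := lprod denAL1 (p.a : ℚ) p.b p.e p.f p.g t) (d2 := lprod denAL2 (p.a : ℚ) p.b p.e p.f p.g t)
    (d3 := lprod denAL3 (p.a : ℚ) p.b p.e p.f p.g t)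
    (tn := lprod tnAL (p.a : ℚ) p.b p.e p.f p.g t) (td := lprod tdAL (p.a : ℚ) p.b p.e p.f p.g t)
    (cnum := lprod cnumAL (p.a : ℚ) p.b p.e p.f p.g t) (cnumS := lprod cnumSAL (p.a : ℚ) p.b p.e p.f p.g t)
    (cden := lprod cdenAL (p.a : ℚ) p.b p.e p.f p.g t) (cdenS := lprod cdenSAL (p.a : ℚ) p.b p.e p.f p.g t)
    (x0 := polyTN xAL 0 (p.a : ℚ) p.b p.e p.f p.g t) (x1 := polyTN xAL 1 (p.a : ℚ) p.b p.e p.f p.g t)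
    (by rw [denAL1_eval, numAL1_eval]; linear_combination r1)
    (by rw [denAL2_eval, numAL2_eval]; linear_combination r2)
    (by rw [denAL3_eval, numAL3_eval]; linear_combination r3)
    (by rw [tdAL_eval, tnAL_eval]; linear_combination hshift)
    (by rw [denAL1_eval]; exact mul_ne_zero (fun h => m1 (by linarith)) (fun h => n1 (by linarith)))
    (by rw [denAL2_eval]
        exact mul_ne_zero (mul_ne_zero (mul_ne_zero (fun h => m1 (by linarith)) (fun h => m2 (by linarith)))
          (fun h => n1 (by linarith))) (fun h => n2 (by linarith)))
    (by rw [denAL3_eval]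
        exact mul_ne_zero (mul_ne_zero (mul_ne_zero (mul_ne_zero (mul_ne_zero (fun h => m1 (by linarith))
          (fun h => m2 (by linarith))) (fun h => m3 (by linarith))) (fun h => n1 (by linarith))) (fun h => n2 (by linarith)))
          (fun h => n3 (by linarith)))
    (by rw [tdAL_eval]
        exact mul_ne_zero (mul_ne_zero (mul_ne_zero (fun h => h1' (by linarith)) (fun h => m1 (by linarith)))
          (fun h => n1 (by linarith))) (fun h => hg (by linarith)))
    (by rw [cdenAL_eval]
        exact mul_ne_zero (mul_ne_zero (mul_ne_zero (mul_ne_zero (mul_ne_zero (fun h => m1 (by linarith))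
          (fun h => n1 (by linarith))) (fun h => m2 (by linarith))) (fun h => n2 (by linarith))) (fun h => m3 (by linarith)))
          (fun h => n3 (by linarith)))
    (by rw [cdenSAL_eval]
        exact mul_ne_zero (mul_ne_zero (mul_ne_zero (mul_ne_zero (mul_ne_zero (fun h => m2 (by linarith))
          (fun h => n2 (by linarith))) (fun h => m3 (by linarith))) (fun h => n3 (by linarith))) (fun h => m4 (by linarith)))
          (fun h => n4 (by linarith)))
    (by rw [c0, c1, c2, c3]; linear_combination hc)
  rw [eG1, eG0, key, cnumSAL_eval, cnumAL_eval, cdenSAL_eval, cdenAL_eval]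
  push_cast
  ring

/-! ### Step (3): the DATA identity -/

/-- **Data identity** `Σ_k c^a_k(p)·vL(p+kδ_a) = S G − G` (Lemma U over `SaL`). -/
theorem dataId_aL (h0 : p.Omega) (h1 : (p.addA 1).Omega) (h2 : (p.addA 2).Omega) (h3 : (p.addA 3).Omega) :
    PF.comb4 p.coefA ![p.vL, (p.addA 1).vL, (p.addA 2).vL, (p.addA 3).vL] = p.GfAL.shift.add (p.GfAL.smul (-1)) := by
  have hp := h0.pos
  have hvk : ∀ q : Pt, q.Omega → p.a ≤ q.a → q.g = p.g → q.vL.poles ⊆ p.SaL := fun q hq hqa hqg k hk => by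
    have hk' := poles_vL q hk
    rw [amax_t1a_eq] at hk'; have := hq.e_le; have := hq.f_le; rw [mem_Ico] at hk'
    unfold SaL; rw [mem_Icc]; omega
  refine PF.eq_of_eval_eq_on _ _ p.SaL ?_ ?_ fun t ht => ?_
  · refine (PF.poles_comb4_subset _ _).trans (union_subset (union_subset ?_ ?_) (union_subset ?_ ?_)) <;>
      simp only [Matrix.cons_val_zero, Matrix.cons_val_one, Matrix.cons_val_two, Matrix.cons_val_three,
        Matrix.head_cons, Matrix.tail_cons]
    · exact hvk p h0 le_rfl rfl
    · exact hvk _ h1 (by simp) rfl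
    · exact hvk _ h2 (by simp) rfl
    · exact hvk _ h3 (by simp) rfl
  · refine (PF.poles_shift_sub_subset _).trans (union_subset ?_ ((poles_GfAL p).trans fun k hk => ?_))
    · intro k hk
      obtain ⟨j, hj, rfl⟩ := mem_image.1 hk
      have hj' := poles_GfAL p hj
      unfold SaL; rw [mem_Icc]; rw [mem_Ico] at hj'; omega
    · unfold SaL; rw [mem_Icc]; rw [mem_Ico] at hk; omega
  · rw [PF.eval_comb4, PF.eval_shift_sub, Fin.sum_univ_four]
    simp only [Matrix.cons_val_zero, Matrix.cons_val_one, Matrix.cons_val_two, Matrix.cons_val_three,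
      Matrix.head_cons, Matrix.tail_cons]
    exact funId_aL h0 h1 h2 h3 ht

/-! ### Step (4): legitimacy at the common node `s* = node(p)` -/

/-- `ρ⁰_{s*}(G) = ρ¹_{s*}(G) = 0` at the node of `p` (double zero of `N_G`; uses the base-point inequalities from `p+3δ_a ∈ Ω`). -/
theorem GfAL_rho (h0 : p.Omega) (h3 : (p.addA 3).Omega) : rho0 p.nodeL p.GfAL = 0 ∧ rho1 p.nodeL p.GfAL = 0 := by
  have sp := a2star_t1a_lin h0
  obtain ⟨b1, b2, b3, b4⟩ := base_ineq_addA p h3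
  obtain ⟨o1, o2, o3, o4, o5, o6, o7, o8, o9⟩ := h0
  set m := a2star p.t1a with hm
  have hnode : p.nodeL = -(m - 1) := by show 1 - a2star p.t1a = _; rw [← hm]; ring
  have hc : m - 1 ∉ Ico p.a (p.g - 1) := by rw [mem_Ico]; omega
  rw [hnode]
  refine ⟨PF.rho0_ofFrac_eq_zero _ _ _ (fun _ _ => Or.inl rfl) hc ?_, PF.rho1_ofFrac_eq_zero _ _ _ hc⟩
  have hcases : (0 ≤ m - 1 ∧ m - 1 < p.e ∧ p.a - p.e + 3 ≤ m - 1 ∧ m - 1 < p.f)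
      ∨ (0 ≤ m - 1 ∧ m - 1 < p.e ∧ p.a - p.f + 3 ≤ m - 1 ∧ m - 1 < p.b)
      ∨ (p.a - p.e + 3 ≤ m - 1 ∧ m - 1 < p.f ∧ p.a - p.f + 3 ≤ m - 1 ∧ m - 1 < p.b) := by omega
  unfold NfAL
  refine Dvd.dvd.mul_right ?_ _
  rcases hcases with ⟨a1, a2, a3, a4⟩ | ⟨a1, a2, a3, a4⟩ | ⟨a1, a2, a3, a4⟩
  · exact (pow_two (lin (m - 1)) ▸ mul_dvd_mul (lin_dvd_block a1 a2) (lin_dvd_block a3 a4)).mul_right _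
  · refine (pow_two (lin (m - 1)) ▸ mul_dvd_mul (lin_dvd_block a1 a2) (lin_dvd_block a3 a4)).trans ?_
    exact ⟨block (p.a - p.e + 3) p.f, by ring⟩
  · refine (pow_two (lin (m - 1)) ▸ mul_dvd_mul (lin_dvd_block a1 a2) (lin_dvd_block a3 a4)).trans ?_
    exact ⟨block 0 p.e, by ring⟩

/-! ### Step (6): the first-tale recurrence of direction `a` -/

/-- Along `δ_a` the integer `d` decreases by `k`. -/
theorem dInt_addA (p : Pt) (k : ℤ) : (p.addA k).dInt = p.dInt - k := by simp [dInt, addA]; ring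

/-- **Direction `a`, first tale.** For `p, p+δ, p+2δ, p+3δ ∈ Ω` (`δ = δ_a`):
`Σ_k c^a_k(p)·Λ¹_{node(p+kδ)}[vL(p+kδ)] = 0` and the same for `Λ⁰` with the common truncation `D = d⁺(p) + 10`. -/
theorem recL_a (h0 : p.Omega) (h1 : (p.addA 1).Omega) (h2 : (p.addA 2).Omega) (h3 : (p.addA 3).Omega) :
    (p.coefA 0 * lam1 p.nodeL p.vL + p.coefA 1 * lam1 (p.addA 1).nodeL (p.addA 1).vL
      + p.coefA 2 * lam1 (p.addA 2).nodeL (p.addA 2).vL + p.coefA 3 * lam1 (p.addA 3).nodeL (p.addA 3).vL = 0) ∧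
    (p.coefA 0 * lam0 (dExp p.t1a p.t1b + 10) p.nodeL p.vL
      + p.coefA 1 * lam0 (dExp p.t1a p.t1b + 10) (p.addA 1).nodeL (p.addA 1).vL
      + p.coefA 2 * lam0 (dExp p.t1a p.t1b + 10) (p.addA 2).nodeL (p.addA 2).vL
      + p.coefA 3 * lam0 (dExp p.t1a p.t1b + 10) (p.addA 3).nodeL (p.addA 3).vL = 0) := by
  set D := dExp p.t1a p.t1b + 10 with hDdef
  have hdata := dataId_aL h0 h1 h2 h3
  have hrho := GfAL_rho h0 h3
  have s1 := lam1_step p.nodeL p.coefA _ p.GfAL hdata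
  have s0 := lam0_step D p.nodeL p.coefA _ p.GfAL hdata (natDegree_GfAL_le p h0)
  rw [Fin.sum_univ_four] at s1 s0
  simp only [Matrix.cons_val_zero, Matrix.cons_val_one, Matrix.cons_val_two, Matrix.cons_val_three,
    Matrix.head_cons, Matrix.tail_cons] at s1 s0
  rw [hrho.2] at s1
  rw [hrho.1] at s0
  rw [nodeL_addA h0 h1, nodeL_addA h0 h2, nodeL_addA h0 h3]
  exact ⟨s1, s0⟩

end Pt

end Summit.KontsevichZagierPeriods.Zeta5Search.TwoTaleOmega

end
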